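import Literature.IUT.HodgeTheaters.ThetaPMEllNFHodgeTheatersD
import Literature.IUT.HodgeTheaters.ThetaPMEllGluingRigidityLaw
import HarnessLib

/-!
# [IUTchI] Definition 6.13 (ii)(c) and Proposition 6.7 at the `𝒟`-level: uniqueness of the gluing from the
# label-rigidity law, and isomorphy / functoriality of Proposition 6.7's outputs without it (proof-only)

S. Mochizuki, *Inter-universal Teichmüller theory I*, §6, Remark 6.12.2 (i), (ii) pp. 174–175 ("A similar
[but easier!] construction may be given for `𝒟-Θ`-bridges and `𝒟-Θ^±`-bridges"; "one may glue a
`𝒟-Θ^{±ell}`-Hodge theater to a `𝒟-ΘNF`-Hodge theater") and Definition 6.13 (ii)(c) p. 183 ("the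
[necessarily unique!] gluing isomorphism"); §4, Example 4.4 (iv) p. 107, Proposition 4.8 (ii) p. 115
([IUTchI] Def 6.13 (ii) p.183) [claim: Mochizuki2012, status: disputed].  Consistency analysis of the typed
`𝒟`-level gluing datum `S5Local.DThetaGluing` (abc-iut-L5-t4, `ThetaPMEllNFHodgeTheatersD.lean`); no IUT
content is asserted, no side is taken.

## What is proved (theorems only; hypotheses inline)

* `DThetaPMBridge.thetaBridgeData_labelFamily_eq`: the `𝒟`-level (general `𝒟-Θ^±`-bridge) form of the
  prequel's lemma — by abc-iut-L5-t4's `exists_label_compat_of_cod` the `(α, β)`-compatibility filter of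
  Proposition 6.7's bad-place poly-morphisms is immaterial, the composite family at a label `q ∈ T^⋆`
  being the bi-saturation `Iso(X, 𝒟_v) · thetaPolyBad (label q) v · Iso(𝒟_v, †𝒟_{≻,v})`.
* `S5Local.DThetaGluing.ext_indexEquiv`: a `𝒟`-gluing is its index bijection.
* `S5Local.dGluing_subsingleton_of_labelRigid` / `…_of_thetaPolyBad_labelRigid`: **Def 6.13 (ii)(c)
  "[necessarily unique!]" holds for every pair (`𝒟-Θ^±`-bridge, `𝒟-ΘNF`-Hodge theater) as soon as the kit
  law of plan/GAP-LEDGER.md row G-w4d056-1 — injectivity in the label `j ∈ 𝔽_l^⋇` of the bi-saturated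
  Example-4.4 poly-morphisms `thetaPolyBad j v` ([IUTchI] Ex 4.4 (iv)) — holds at ONE bad place.**
* `S5Local.gluing_subsingleton_of_dGluing_subsingleton`: `𝒟`-level uniqueness implies `ℱ`-level uniqueness
  (through abc-iut-L5-t4's `ThetaGluing.toD`, for any isomorphism kit `IsoKit`); contrapositively, over
  any kit carrying an `IsoKit`, a failure of `ℱ`-level uniqueness (as in the prequel's witness
  `PMBaseKit.exists_kit_bad_nonempty_not_gluingUnique`) is a failure of `𝒟`-level uniqueness.

* **Functoriality / existence (no law needed)** — row (L6) of abc-iut-L5-t4's map of Prop 6.7 (INBOX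
  2026-08-26T00:17:47Z): `DThetaPMBridge.thetaBridgeData_rightFamily_eq` (+ the good-place forms
  `…_rightFamily_eq_of_not_bad`, `…_labelFamily_eq_of_not_bad`), `exists_starLabel_preserving_equiv`
  (label-matching `T₁^⋆ ⥲ T₂^⋆` from abc-iut-w4-d054's `starLabel_bijective`),
  **`thetaBridgeData_compat_of_starLabel_preserving`** and **`exists_thetaBridgeData_iso(_of_iso)`**: the
  Prop-6.7 outputs of ANY two `𝒟-Θ^±`-bridges over one kit are isomorphic `𝒟-Θ`-bridge data in the sense of
  Def 4.6 (ii) (label-matching index bijection, capsule-full / full poly-isomorphisms compatible with the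
  Θ-poly-morphisms) — the EXISTENCE half of "[well-defined, up to a unique isomorphism!]" (Prop 6.7 /
  Prop 4.8 (ii)) is derivable from the kits; only the UNIQUENESS half needs the label-rigidity law.

Proof-only: no `def`, no new `Prop` fact. typed ≠ proved.
-/

namespace Literature.IUT.HodgeTheaters

open CategoryTheory

universe u

namespace PMBaseKit

namespace DThetaPMBridge

variable {l : ℕ} {K : PMBaseKit.{u} l} (B : K.DThetaPMBridge) (M : K.MultKit)

/-- `𝒟`-level form of `FKit.ThetaPMBridge.thetaBridgeData_labelFamily_eq`: at `v ∈ 𝕍^bad`, for every label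
`q ∈ T^⋆` and object `X`, the family of composites `X ⥲ †𝒟_{v_q} → †𝒟_{≻,v}` through Proposition 6.7's
`𝒟-Θ`-bridge is the bi-saturation of the kit's Example-4.4 poly-morphism with the label of `q`.
([IUTchI] Prop 6.7 p.167) [claim: Mochizuki2012, status: disputed] -/
theorem thetaBridgeData_labelFamily_eq (hl : Odd l) {v : K.V} (hv : v ∈ K.bad)
    (q : B.grpT.AbsStar) (X : K.Amb v) :
    {h : X ⟶ B.codomain.obj v |
        ∃ (φ : X ≅ (B.starCapsule q).obj v) (g : (B.starCapsule q).obj v ⟶ B.codomain.obj v),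
          g ∈ (B.thetaBridgeData M hl).poly ⟨q⟩ v ∧ h = φ.hom ≫ g} =
      {h : X ⟶ B.codomain.obj v |
        ∃ (ψ : X ≅ K.model v) (g : K.model v ⟶ K.model v) (β : K.model v ≅ B.codomain.obj v),
          g ∈ M.thetaPolyBad (B.starLabel hl q) v hv ∧ h = ψ.hom ≫ g ≫ β.hom} := by
  ext h
  constructor
  · rintro ⟨φ, g', hg', rfl⟩
    simp only [DThetaPMBridge.thetaBridgeData, dif_pos hv] at hg'
    obtain ⟨α, β, -, g, hg, rfl⟩ := hg'
    refine ⟨φ ≪≫ α.symm, g, β, hg, ?_⟩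
    simp only [Iso.trans_hom, Iso.symm_hom, Category.assoc]
  · rintro ⟨ψ, g, β, hg, rfl⟩
    obtain ⟨α, hα⟩ := B.exists_label_compat_of_cod (Quotient.out q.1) v β
    refine ⟨ψ ≪≫ α, α.inv ≫ g ≫ β.hom, ?_, by simp⟩
    simp only [DThetaPMBridge.thetaBridgeData, dif_pos hv]
    exact ⟨α, β, hα, g, hg, rfl⟩

/-- `𝒟`-level form of `FKit.ThetaPMBridge.labelRigidAt_of_thetaPolyBad_labelRigid`: the kit law at a bad
place `v` (bi-saturated `thetaPolyBad j v` pairwise distinct, [IUTchI] Ex 4.4 (iv)) makes the Prop-6.7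
family of ANY `𝒟-Θ^±`-bridge injective in the label at every isomorph `X` of `𝒟_v`.
([IUTchI] Prop 4.8 (ii) p.115) [claim: Mochizuki2012, status: disputed] -/
theorem labelRigidAt_of_thetaPolyBad_labelRigid (hl : Odd l) {v : K.V} (hv : v ∈ K.bad)
    (hrig : Function.Injective fun j : Fin ((l - 1) / 2) =>
      {k : K.model v ⟶ K.model v | ∃ (θ : K.model v ≅ K.model v) (g : K.model v ⟶ K.model v)
        (β : K.model v ≅ K.model v), g ∈ M.thetaPolyBad j v hv ∧ k = θ.hom ≫ g ≫ β.hom})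
    (X : K.Amb v) (hX : K.IsLocal v X) :
    Function.Injective fun q : B.grpT.AbsStar =>
      {h : X ⟶ B.codomain.obj v |
        ∃ (φ : X ≅ (B.starCapsule q).obj v) (g : (B.starCapsule q).obj v ⟶ B.codomain.obj v),
          g ∈ (B.thetaBridgeData M hl).poly ⟨q⟩ v ∧ h = φ.hom ≫ g} := by
  intro q q' hqq'
  have h1 := hqq'
  simp only [B.thetaBridgeData_labelFamily_eq M hl hv] at h1
  obtain ⟨ψ₀⟩ := hX
  obtain ⟨γ⟩ := B.codomain.isLocal v
  have h2 := biSaturation_eq_of_transport_eq ψ₀ γ.symm h1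
  exact (B.starLabel_bijective hl).1 (hrig h2)

end DThetaPMBridge

namespace S5Local

variable {l : ℕ} {K : PMBaseKit.{u} l} {M : K.MultKit} {FK : K.FKit M} (N : K.S5Local M FK)

/-- A `𝒟`-level gluing datum (Rmk 6.12.2 (i), `𝒟`-level; Def 6.13 (ii)(c)) is determined by its index
bijection `J ⥲ T^⋆`. ([IUTchI] Def 6.13 (ii) p.183) [claim: Mochizuki2012, status: disputed] -/
theorem DThetaGluing.ext_indexEquiv {hl : Odd l} {B : K.DThetaPMBridge} {X : N.DNFHT}
    {G G' : N.DThetaGluing B X hl} (h : G.indexEquiv = G'.indexEquiv) : G = G' := by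
  obtain ⟨ι, hc⟩ := G
  obtain ⟨ι', hc'⟩ := G'
  obtain rfl : ι = ι' := h
  rfl

/-- **Def 6.13 (ii)(c), conditional (index-wise form).** If for every index `j ∈ J` the Prop-6.7
composite family (the left-hand side of the `𝒟`-gluing compatibility) is injective in the label
`q ∈ T^⋆`, the `𝒟`-level gluing is unique. ([IUTchI] Def 6.13 (ii) p.183) [claim: Mochizuki2012, status: disputed] -/
theorem dGluing_subsingleton_of_labelRigid (hl : Odd l) (B : K.DThetaPMBridge) (X : N.DNFHT)
    (hrig : ∀ j : X.thBridge.J, Function.Injective fun (q : B.grpT.AbsStar) (v : K.V) =>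
      {h : (X.thBridge.capsule j).obj v ⟶ B.codomain.obj v |
        ∃ (φ : (X.thBridge.capsule j).obj v ≅ (B.starCapsule q).obj v)
          (g : (B.starCapsule q).obj v ⟶ B.codomain.obj v),
          g ∈ (B.thetaBridgeData M hl).poly ⟨q⟩ v ∧ h = φ.hom ≫ g}) :
    Subsingleton (N.DThetaGluing B X hl) := by
  refine ⟨fun G G' => DThetaGluing.ext_indexEquiv N (Equiv.ext fun j => hrig j ?_)⟩
  funext v
  exact (G.compat j v).trans (G'.compat j v).symm

/-- **Def 6.13 (ii)(c) "[necessarily unique!]" from the kit law** ([IUTchI] Rmk 6.12.2 (i)/(ii) p. 174,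
Def 6.13 (ii) p. 183): if at some `v ∈ 𝕍^bad` the bi-saturated Example-4.4 poly-morphisms of the
multiplicative kit are pairwise distinct for distinct labels `j ∈ 𝔽_l^⋇` (Ex 4.4 (iv): the labels "are held
fixed by arbitrary automorphisms of `𝒟_>`") — the law of plan/GAP-LEDGER.md row G-w4d056-1 — then for
EVERY `𝒟-Θ^±`-bridge `B` and `𝒟-ΘNF`-Hodge theater `X` the `𝒟`-level gluing of `X` to `B` via Proposition 6.7
is unique. ([IUTchI] Def 6.13 (ii) p.183) [claim: Mochizuki2012, status: disputed] -/
theorem dGluing_subsingleton_of_thetaPolyBad_labelRigid (hl : Odd l) {v : K.V} (hv : v ∈ K.bad)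
    (hrig : Function.Injective fun j : Fin ((l - 1) / 2) =>
      {k : K.model v ⟶ K.model v | ∃ (θ : K.model v ≅ K.model v) (g : K.model v ⟶ K.model v)
        (β : K.model v ≅ K.model v), g ∈ M.thetaPolyBad j v hv ∧ k = θ.hom ≫ g ≫ β.hom})
    (B : K.DThetaPMBridge) (X : N.DNFHT) : Subsingleton (N.DThetaGluing B X hl) :=
  N.dGluing_subsingleton_of_labelRigid hl B X fun j _ _ hqq' =>
    B.labelRigidAt_of_thetaPolyBad_labelRigid M hl hv hrig _ ((X.thBridge.capsule j).isLocal v)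
      (congrFun hqq' v)

/-- **`𝒟`-level uniqueness implies `ℱ`-level uniqueness** (through abc-iut-L5-t4's passage
`ThetaGluing.toD` to the associated `𝒟`-objects, which keeps the index bijection): for a Θ^±-bridge `B`
and a ΘNF-Hodge theater `H`, if the `𝒟`-gluing of the associated `𝒟-ΘNF`-Hodge theater to the
associated `𝒟-Θ^±`-bridge is unique, so is the gluing of `H` to `B` (Rmk 6.12.2 (ii)); contrapositively, a
failure of `ℱ`-level uniqueness over a kit carrying an `IsoKit` is a failure of `𝒟`-level uniqueness.
([IUTchI] Rmk 6.12.2 (ii) p.174) [claim: Mochizuki2012, status: disputed] -/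
theorem gluing_subsingleton_of_dGluing_subsingleton (NI : N.IsoKit) (hl : Odd l) (B : FK.ThetaPMBridge)
    (H : N.ThetaNFHT) (h : Subsingleton (N.DThetaGluing B.dBridge (NI.assocD H) hl)) :
    Subsingleton (N.ThetaGluing B H hl) := by
  refine ⟨fun G G' => ThetaGluing.ext_indexEquiv N ?_⟩
  have hD : (G.toD NI).indexEquiv = (G'.toD NI).indexEquiv := congrArg _ (h.elim _ _)
  ext j
  have h1 := Equiv.congr_fun hD ⟨j⟩
  simp only [ThetaGluing.toD] at h1
  exact h1

end S5Local

/-! ### Proposition 6.7 is functorial: any two outputs are isomorphic (no law needed) -/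

namespace DThetaPMBridge

variable {l : ℕ} {K : PMBaseKit.{u} l} (B : K.DThetaPMBridge) (M : K.MultKit)

/-- At a bad place, the RIGHT-composite family of Proposition 6.7's poly-morphism with all isomorphisms
`†𝒟_{≻,v} ⥲ Z'` is the bi-saturation `Iso(†𝒟_{v_q}, 𝒟_v) · thetaPolyBad (label q) v · Iso(𝒟_v, Z')` of the
kit's Example-4.4 poly-morphism (Ex 4.4 (ii): "composing with arbitrary isomorphisms").
([IUTchI] Prop 6.7 p.167) [claim: Mochizuki2012, status: disputed] -/
theorem thetaBridgeData_rightFamily_eq (hl : Odd l) {v : K.V} (hv : v ∈ K.bad) (q : B.grpT.AbsStar)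
    (Z' : K.Amb v) :
    {h : (B.starCapsule q).obj v ⟶ Z' |
        ∃ (f : (B.starCapsule q).obj v ⟶ B.codomain.obj v) (ψ : B.codomain.obj v ≅ Z'),
          f ∈ (B.thetaBridgeData M hl).poly ⟨q⟩ v ∧ h = f ≫ ψ.hom} =
      {h : (B.starCapsule q).obj v ⟶ Z' |
        ∃ (ψ : (B.starCapsule q).obj v ≅ K.model v) (g : K.model v ⟶ K.model v) (β : K.model v ≅ Z'),
          g ∈ M.thetaPolyBad (B.starLabel hl q) v hv ∧ h = ψ.hom ≫ g ≫ β.hom} := by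
  ext h
  constructor
  · rintro ⟨f, ψ, hf, rfl⟩
    simp only [DThetaPMBridge.thetaBridgeData, dif_pos hv] at hf
    obtain ⟨α, β, -, g, hg, rfl⟩ := hf
    exact ⟨α.symm, g, β ≪≫ ψ, hg, by simp⟩
  · rintro ⟨ψ, g, β, hg, rfl⟩
    obtain ⟨β₁, hβ₁⟩ := B.exists_label_compat_of_caps (Quotient.out q.1) v ψ.symm
    refine ⟨ψ.symm.inv ≫ g ≫ β₁.hom, β₁.symm ≪≫ β, ?_, by simp⟩
    simp only [DThetaPMBridge.thetaBridgeData, dif_pos hv]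
    exact ⟨ψ.symm, β₁, hβ₁, g, hg, rfl⟩

/-- At a good place `v ∉ 𝕍^bad`, the right-composite family is the set of ALL isomorphisms
`†𝒟_{v_q} ⥲ Z'` (Prop 6.7: "the corresponding full poly-morphisms"), `Z'` an isomorph of `𝒟_v`.
([IUTchI] Prop 6.7 p.167) [claim: Mochizuki2012, status: disputed] -/
theorem thetaBridgeData_rightFamily_eq_of_not_bad (hl : Odd l) {v : K.V} (hv : v ∉ K.bad)
    (q : B.grpT.AbsStar) (Z' : K.Amb v) (hZ' : K.IsLocal v Z') :
    {h : (B.starCapsule q).obj v ⟶ Z' |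
        ∃ (f : (B.starCapsule q).obj v ⟶ B.codomain.obj v) (ψ : B.codomain.obj v ≅ Z'),
          f ∈ (B.thetaBridgeData M hl).poly ⟨q⟩ v ∧ h = f ≫ ψ.hom} =
      {h : (B.starCapsule q).obj v ⟶ Z' | ∃ e : (B.starCapsule q).obj v ≅ Z', h = e.hom} := by
  ext h
  constructor
  · rintro ⟨f, ψ, hf, rfl⟩
    simp only [DThetaPMBridge.thetaBridgeData, dif_neg hv] at hf
    obtain ⟨e, rfl⟩ := hf
    exact ⟨e ≪≫ ψ, by simp⟩
  · rintro ⟨e, rfl⟩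
    obtain ⟨γZ⟩ := B.codomain.isLocal v
    obtain ⟨γ'⟩ := hZ'
    refine ⟨(e ≪≫ γ' ≪≫ γZ.symm).hom, γZ ≪≫ γ'.symm, ?_, by simp⟩
    simp only [DThetaPMBridge.thetaBridgeData, dif_neg hv]
    exact ⟨e ≪≫ γ' ≪≫ γZ.symm, rfl⟩

/-- At a good place the LEFT-composite family `{φ ≫ g | φ : X ⥲ †𝒟_{v_q}, g ∈ †φ^Θ_{v_q}}` is likewise the set
of all isomorphisms `X ⥲ †𝒟_{≻,v}` (`𝒟`-level form of the `ℱ`-level lemma of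
`ThetaPMEllGluingRigidityNecessity.lean`). ([IUTchI] Prop 6.7 p.167) [claim: Mochizuki2012, status: disputed] -/
theorem thetaBridgeData_labelFamily_eq_of_not_bad (hl : Odd l) {v : K.V} (hv : v ∉ K.bad)
    (q : B.grpT.AbsStar) (X : K.Amb v) :
    {h : X ⟶ B.codomain.obj v |
        ∃ (φ : X ≅ (B.starCapsule q).obj v) (g : (B.starCapsule q).obj v ⟶ B.codomain.obj v),
          g ∈ (B.thetaBridgeData M hl).poly ⟨q⟩ v ∧ h = φ.hom ≫ g} =
      {h : X ⟶ B.codomain.obj v | ∃ e : X ≅ B.codomain.obj v, h = e.hom} := by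
  ext h
  constructor
  · rintro ⟨φ, g', hg', rfl⟩
    simp only [DThetaPMBridge.thetaBridgeData, dif_neg hv] at hg'
    obtain ⟨f, rfl⟩ := hg'
    exact ⟨φ ≪≫ f, by simp⟩
  · rintro ⟨e, rfl⟩
    obtain ⟨γY⟩ := (B.starCapsule q).isLocal v
    obtain ⟨γZ⟩ := B.codomain.isLocal v
    refine ⟨e ≪≫ γZ ≪≫ γY.symm, (γY ≪≫ γZ.symm).hom, ?_, by simp⟩
    simp only [DThetaPMBridge.thetaBridgeData, dif_neg hv]
    exact ⟨γY ≪≫ γZ.symm, rfl⟩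

/-- The canonical labellings `T₁^⋆ ⥲ 𝔽_l^⋇`, `T₂^⋆ ⥲ 𝔽_l^⋇` of two `𝒟-Θ^±`-bridges (Def 6.4 (i) p. 162:
`T^⋆ := |T| ∖ {0}`, with the labels `|t| ∈ |𝔽_l|` of the underlying `𝔽_l^±`-torsor — not a quotation; both
maps are bijections, abc-iut-w4-d054 `starLabel_bijective`) compose to a LABEL-MATCHING bijection
`ι : T₁^⋆ ⥲ T₂^⋆` — the index bijection of the isomorphism of Prop 4.8 (ii) between the two outputs of
Proposition 6.7. ([IUTchI] Def 6.4 (i) p.162) [claim: Mochizuki2012, status: disputed] -/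
theorem exists_starLabel_preserving_equiv (hl : Odd l) (B₁ B₂ : K.DThetaPMBridge) :
    ∃ ι : B₁.grpT.AbsStar ≃ B₂.grpT.AbsStar, ∀ q, B₂.starLabel hl (ι q) = B₁.starLabel hl q := by
  refine ⟨(Equiv.ofBijective _ (B₁.starLabel_bijective hl)).trans
      (Equiv.ofBijective _ (B₂.starLabel_bijective hl)).symm, fun q => ?_⟩
  simp only [Equiv.trans_apply, Equiv.ofBijective_apply]
  exact Equiv.ofBijective_apply_symm_apply _ (B₂.starLabel_bijective hl) _

/-- **Prop 6.7 — the outputs are compatible along any label-matching index bijection** (Def 4.6 (ii);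
the shape of `S5Local.DThetaGluing.compat`): for `𝒟-Θ^±`-bridges `B₁, B₂` and a bijection `ι : T₁^⋆ ⥲ T₂^⋆`
with `lab₂ ∘ ι = lab₁`, at every place the composite of the capsule-FULL poly-isomorphism
`†𝒟¹_{v_q} ⥲ †𝒟²_{v_{ι q}}` with `†φ²^Θ_{v_{ι q}}` equals the composite of `†φ¹^Θ_{v_q}` with the FULL
poly-isomorphism `†𝒟¹_{≻,v} ⥲ †𝒟²_{≻,v}`: at bad places both are the bi-saturation of the kit's Example-4.4
poly-morphism with the common label, at good places both are the full poly-isomorphism.  NO label-rigidity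
law is used. ([IUTchI] Prop 6.7 p.167) [claim: Mochizuki2012, status: disputed] -/
theorem thetaBridgeData_compat_of_starLabel_preserving (hl : Odd l) (B₁ B₂ : K.DThetaPMBridge)
    (ι : B₁.grpT.AbsStar ≃ B₂.grpT.AbsStar) (hι : ∀ q, B₂.starLabel hl (ι q) = B₁.starLabel hl q)
    (q : B₁.grpT.AbsStar) (v : K.V) :
    {h : (B₁.starCapsule q).obj v ⟶ B₂.codomain.obj v |
        ∃ (φ : (B₁.starCapsule q).obj v ≅ (B₂.starCapsule (ι q)).obj v)
          (g : (B₂.starCapsule (ι q)).obj v ⟶ B₂.codomain.obj v),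
          g ∈ (B₂.thetaBridgeData M hl).poly ⟨ι q⟩ v ∧ h = φ.hom ≫ g} =
      {h : (B₁.starCapsule q).obj v ⟶ B₂.codomain.obj v |
        ∃ (f : (B₁.starCapsule q).obj v ⟶ B₁.codomain.obj v) (ψ : B₁.codomain.obj v ≅ B₂.codomain.obj v),
          f ∈ (B₁.thetaBridgeData M hl).poly ⟨q⟩ v ∧ h = f ≫ ψ.hom} := by
  by_cases hv : v ∈ K.bad
  · rw [B₂.thetaBridgeData_labelFamily_eq M hl hv (ι q) ((B₁.starCapsule q).obj v),
      B₁.thetaBridgeData_rightFamily_eq M hl hv q (B₂.codomain.obj v), hι q]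
  · rw [B₂.thetaBridgeData_labelFamily_eq_of_not_bad M hl hv (ι q) ((B₁.starCapsule q).obj v),
      B₁.thetaBridgeData_rightFamily_eq_of_not_bad M hl hv q (B₂.codomain.obj v) (B₂.codomain.isLocal v)]

/-- **Prop 6.7 — any two outputs are isomorphic `𝒟-Θ`-bridge data** ("[well-defined, up to a unique
isomorphism!]": the EXISTENCE half of Prop 4.8 (ii) for the outputs of the algorithm): for `𝒟-Θ^±`-bridges
`B₁, B₂` over one kit there is a label-matching index bijection `T₁^⋆ ⥲ T₂^⋆` along which the capsule-full
and full poly-isomorphisms are compatible with the two Θ-poly-morphisms (Def 4.6 (ii)).  Derivable from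
the §6 kits WITHOUT the label-rigidity law (contrast the uniqueness half, plan/GAP-LEDGER.md G-w4d056-1).
([IUTchI] Prop 6.7 p.167) [claim: Mochizuki2012, status: disputed] -/
theorem exists_thetaBridgeData_iso (hl : Odd l) (B₁ B₂ : K.DThetaPMBridge) :
    ∃ ι : B₁.grpT.AbsStar ≃ B₂.grpT.AbsStar, (∀ q, B₂.starLabel hl (ι q) = B₁.starLabel hl q) ∧
      ∀ (q : B₁.grpT.AbsStar) (v : K.V),
        {h : (B₁.starCapsule q).obj v ⟶ B₂.codomain.obj v |
            ∃ (φ : (B₁.starCapsule q).obj v ≅ (B₂.starCapsule (ι q)).obj v)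
              (g : (B₂.starCapsule (ι q)).obj v ⟶ B₂.codomain.obj v),
              g ∈ (B₂.thetaBridgeData M hl).poly ⟨ι q⟩ v ∧ h = φ.hom ≫ g} =
          {h : (B₁.starCapsule q).obj v ⟶ B₂.codomain.obj v |
            ∃ (f : (B₁.starCapsule q).obj v ⟶ B₁.codomain.obj v)
              (ψ : B₁.codomain.obj v ≅ B₂.codomain.obj v),
              f ∈ (B₁.thetaBridgeData M hl).poly ⟨q⟩ v ∧ h = f ≫ ψ.hom} := by
  obtain ⟨ι, hι⟩ := exists_starLabel_preserving_equiv hl B₁ B₂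
  exact ⟨ι, hι, thetaBridgeData_compat_of_starLabel_preserving M hl B₁ B₂ ι hι⟩

/-- **Prop 6.7 is functorial in isomorphisms of `𝒟-Θ^±`-bridges** ("a functorial algorithm", p. 167): an
isomorphism `B₁ ⥲ B₂` of `𝒟-Θ^±`-bridges (Def 6.4 (i)) yields an isomorphism of the output `𝒟-Θ`-bridge data
in the sense of Def 4.6 (ii) — a label-matching index bijection with compatible capsule-full / full
poly-isomorphisms.  (The isomorphism `_f` of `𝒟-Θ^±`-bridges is not even needed for EXISTENCE:
`exists_thetaBridgeData_iso`; the functor's genuine VALUE on `_f` — the Def-4.6 (ii) morphism over the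
bijection `|t| ↦ |ι(t)|` induced by `_f` on nonzero `{±1}`-classes — is abc-iut-w5-d228's
`DThetaPMBridge.thetaBridgeData_map` / `Iso.absStarEquiv` in `PMBaseProp67AlgorithmSub.lean`.)
([IUTchI] Prop 6.7 p.167) [claim: Mochizuki2012, status: disputed] -/
theorem exists_thetaBridgeData_iso_of_iso (hl : Odd l) {B₁ B₂ : K.DThetaPMBridge} (_f : Iso B₁ B₂) :
    ∃ ι : B₁.grpT.AbsStar ≃ B₂.grpT.AbsStar, (∀ q, B₂.starLabel hl (ι q) = B₁.starLabel hl q) ∧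
      ∀ (q : B₁.grpT.AbsStar) (v : K.V),
        {h : (B₁.starCapsule q).obj v ⟶ B₂.codomain.obj v |
            ∃ (φ : (B₁.starCapsule q).obj v ≅ (B₂.starCapsule (ι q)).obj v)
              (g : (B₂.starCapsule (ι q)).obj v ⟶ B₂.codomain.obj v),
              g ∈ (B₂.thetaBridgeData M hl).poly ⟨ι q⟩ v ∧ h = φ.hom ≫ g} =
          {h : (B₁.starCapsule q).obj v ⟶ B₂.codomain.obj v |
            ∃ (f : (B₁.starCapsule q).obj v ⟶ B₁.codomain.obj v)
              (ψ : B₁.codomain.obj v ≅ B₂.codomain.obj v),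
              f ∈ (B₁.thetaBridgeData M hl).poly ⟨q⟩ v ∧ h = f ≫ ψ.hom} :=
  exists_thetaBridgeData_iso M hl B₁ B₂

end DThetaPMBridge

end PMBaseKit

end Literature.IUT.HodgeTheaters
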